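import Mathlib
import Literature.Computability.AlgebraicComplexity.BorderRankMatMulTwoApolarity
import Literature.Computability.AlgebraicComplexity.BorderApolarityGeneric

/-!
# Stub `stub_passingFrame_of_borderRank_le_six` (G1 — weak border apolarity at `(n, r) = (2, 6)`, frame form)

Line `sharp-grassmann-apolarity` of the crux `FidelityWitnesses.SevenEighthsLaw`
(stmt-MatrixMultiplication-4959).

Write `P2 = Fin 2 × Fin 2`. For a tensor `S : P2 → P2 → P2 → ℂ` (first slot = output `C`, then
`A`, `B`) of algebraic border rank `≤ 6` over `ℂ[ε]` we produce an ORTHONORMAL `10`-frame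
`Y : Fin 10 → (P2 × P2 → ℂ)` of bilinear forms on `A × B` (standard Hermitian product of
`ℂ^{P2 × P2}`: `∑ p, ‖Y r p‖² = 1`, `∑ p, conj (Y r p) * Y r' p = 0` for `r ≠ r'`) with

* every `Y r` annihilating the output slices of `S` (`Y r ∈ annSub S`), and
* the `(210)` and `(120)` multiplication maps of `Y` of rank `≤ 34 = 40 − 6`.

Proof. The first half of the tree's `MatMulTwo.seven_le_algBorderRank_matMulTensor_two`
(Conner–Harper–Landsberg 2023, §2.3 (i)–(iii), made elementary over `ℂ[ε]`), run for a general
`S`: from an order-`h` approximate decomposition with `6` triads (padding a shorter one by zero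
triads), perturbed to general position (`isApproxDecomposition_pert`), the limit space
`F = lim I₁₁₀` has `dim F ≥ 16 − 6 = 10` (`finrank_limSub_eq`, `finrank_I11_ge`), lies in
`annSub S` (`limSub_I11_le_annSub`), and `dim ⨆_{a₀} F · e_{a₀} ≤ dim lim I₂₁₀ ≤ 40 − 6`
(`map_mul210_limSub_le`, `finrank_I21_pert_add_le`, `finrank_symA_le`), likewise for `(120)`.
Then transport `F` to `EuclideanSpace ℂ (P2 × P2)`, take `10` vectors of an orthonormal basis
(`stdOrthonormalBasis`), and note that the range of the `(210)` multiplication map of `Y` lies in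
`⨆_{a₀} F · e_{a₀}` because every `Y r ∈ F`.
-/

set_option linter.dupNamespace false

namespace Summit.MatrixMultiplication.MatrixMultiplication.Theorems.SevenEighthsLaw

open scoped BigOperators ComplexConjugate InnerProductSpace Polynomial
open Polynomial
open Literature.Computability.AlgebraicComplexity

/-- **Weak border apolarity at `(n, r) = (2, 6)`, subspace form.** If `R̲(S) ≤ 6` then some
subspace `F ⊆ annSub S` of bilinear forms on `A × B` has `dim F ≥ 10` and `(210)`/`(120)`
products spanning `≤ 34` dimensions (CHL 2023, §2.3 (i)–(iii); the first half of the tree's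
`MatMulTwo.seven_le_algBorderRank_matMulTensor_two`, verbatim for a general tensor). -/
theorem stub_passingFrame_exists_subspace
    (S : (Fin 2 × Fin 2) → (Fin 2 × Fin 2) → (Fin 2 × Fin 2) → ℂ) (hS : algBorderRank S ≤ 6) :
    ∃ F : Submodule ℂ ((Fin 2 × Fin 2) × (Fin 2 × Fin 2) → ℂ),
      10 ≤ Module.finrank ℂ F ∧ F ≤ annSub S ∧
      Module.finrank ℂ ↥(⨆ a₀ : (Fin 2 × Fin 2), F.map (MatMulTwo.mul210 ℂ a₀)) ≤ 34 ∧
      Module.finrank ℂ ↥(⨆ b₀ : (Fin 2 × Fin 2), F.map (MatMulTwo.mul120 ℂ b₀)) ≤ 34 := by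
  classical
  -- an order-`h` approximate decomposition with exactly `6` triads
  obtain ⟨h, hh⟩ : ∃ h, approxRank h S = algBorderRank S :=
    Nat.sInf_mem (Set.range_nonempty fun h : ℕ => approxRank h S)
  have hr6 : approxRank h S ≤ 6 := by omega
  obtain ⟨u, v, w, huvw⟩ :
      ∃ (u : Fin 6 → (Fin 2 × Fin 2) → ℂ[X]) (v : Fin 6 → (Fin 2 × Fin 2) → ℂ[X])
        (w : Fin 6 → (Fin 2 × Fin 2) → ℂ[X]), IsApproxDecomposition h S u v w :=
    exists_isApproxDecomposition_of_approxRank_le hr6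
  -- six distinct coordinate pairs
  have hr16 : 6 ≤ Fintype.card ((Fin 2 × Fin 2) × (Fin 2 × Fin 2)) := by
    simp [Fintype.card_prod, Fintype.card_fin]
  set pts : Fin 6 → (Fin 2 × Fin 2) × (Fin 2 × Fin 2) :=
    fun ρ => (Fintype.equivFin ((Fin 2 × Fin 2) × (Fin 2 × Fin 2))).symm (Fin.castLE hr16 ρ)
    with hpts
  have hinj : Function.Injective fun ρ => ((pts ρ).1, (pts ρ).2) := by
    simp only [Prod.mk.eta]
    exact (Fintype.equivFin ((Fin 2 × Fin 2) × (Fin 2 × Fin 2))).symm.injective.comp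
      (Fin.castLE_injective hr16)
  -- `N` beyond `h` and all degrees
  set N := h + 1 + (∑ ρ, ∑ a, (v ρ a).natDegree + ∑ ρ, ∑ b, (w ρ b).natDegree) with hN_def
  have hNh : h < N := by omega
  have hN0 : 0 < N := by omega
  have hv : ∀ ρ a, (v ρ a).natDegree < N := by
    intro ρ a
    have h1 : (v ρ a).natDegree ≤ ∑ a, (v ρ a).natDegree :=
      Finset.single_le_sum (f := fun a => (v ρ a).natDegree) (fun _ _ => Nat.zero_le _)
        (Finset.mem_univ a)
    have h2 : ∑ a, (v ρ a).natDegree ≤ ∑ ρ, ∑ a, (v ρ a).natDegree :=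
      Finset.single_le_sum (f := fun ρ => ∑ a, (v ρ a).natDegree) (fun _ _ => Nat.zero_le _)
        (Finset.mem_univ ρ)
    omega
  have hw : ∀ ρ b, (w ρ b).natDegree < N := by
    intro ρ b
    have h1 : (w ρ b).natDegree ≤ ∑ b, (w ρ b).natDegree :=
      Finset.single_le_sum (f := fun b => (w ρ b).natDegree) (fun _ _ => Nat.zero_le _)
        (Finset.mem_univ b)
    have h2 : ∑ b, (w ρ b).natDegree ≤ ∑ ρ, ∑ b, (w ρ b).natDegree :=
      Finset.single_le_sum (f := fun ρ => ∑ b, (w ρ b).natDegree) (fun _ _ => Nat.zero_le _)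
        (Finset.mem_univ ρ)
    omega
  -- the perturbed decomposition and its `(110)` limit space `F`
  have hdec := isApproxDecomposition_pert v w (fun ρ => (pts ρ).1) (fun ρ => (pts ρ).2) N huvw hNh
  set x' := pertX v (fun ρ => (pts ρ).1) N with hx'
  set y' := pertY w (fun ρ => (pts ρ).2) N with hy'
  let L := FractionRing ℂ[X]
  set F : Submodule ℂ ((Fin 2 × Fin 2) × (Fin 2 × Fin 2) → ℂ) := limSub ℂ L (I11 L x' y')
    with hF_def
  have hcard : Fintype.card (Fin 2 × Fin 2) * Fintype.card (Fin 2 × Fin 2) = 16 := by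
    simp [Fintype.card_prod, Fintype.card_fin]
  have hF10 : 10 ≤ Module.finrank ℂ F := by
    have h1 := finrank_limSub_eq ℂ L (I11 L x' y')
    have h2 := finrank_I11_ge L x' y'
    rw [hcard] at h2
    rw [hF_def, h1]
    omega
  have hFann : F ≤ annSub S := limSub_I11_le_annSub L x' y' hdec
  refine ⟨F, hF10, hFann, ?_, ?_⟩
  · have hle : (⨆ a₀ : (Fin 2 × Fin 2), F.map (MatMulTwo.mul210 ℂ a₀)) ≤ limSub ℂ L (I21 L x' y') :=
      iSup_le fun a₀ => map_mul210_limSub_le L x' y' a₀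
    have h1 := finrank_limSub_eq ℂ L (I21 L x' y')
    have h2 := finrank_I21_pert_add_le L hinj hv hw hN0
    rw [← hx', ← hy'] at h2
    have h3 : Module.finrank L ↥(symA L (α := Fin 2 × Fin 2) (β := Fin 2 × Fin 2)) ≤ 40 :=
      MatMulTwo.finrank_symA_le L
    have h4 := Submodule.finrank_mono hle
    omega
  · have hle : (⨆ b₀ : (Fin 2 × Fin 2), F.map (MatMulTwo.mul120 ℂ b₀)) ≤ limSub ℂ L (I12 L x' y') :=
      iSup_le fun b₀ => map_mul120_limSub_le L x' y' b₀
    have h1 := finrank_limSub_eq ℂ L (I12 L x' y')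
    have h2 := finrank_I12_pert_add_le L hinj hv hw hN0
    rw [← hx', ← hy'] at h2
    have h3 : Module.finrank L ↥(symB L (α := Fin 2 × Fin 2) (β := Fin 2 × Fin 2)) ≤ 40 :=
      MatMulTwo.finrank_symB_le L
    have h4 := Submodule.finrank_mono hle
    omega

/-- **Stub G1 — weak border apolarity for border rank `≤ 6`, frame form (the K-input).** Every
tensor `S` in the `2 × 2` format with `R̲(S) ≤ 6` (the tree's `algBorderRank` over `ℂ[ε]`) has an
orthonormal `10`-frame `Y ⊂ annSub S` whose `(210)` and `(120)` multiplication maps have rank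
`≤ 34` (CHL 2023, §2.3 (i)–(iii) plus Gram–Schmidt in `ℂ^{P2 × P2}`). -/
theorem stub_passingFrame_of_borderRank_le_six :
    ∀ S : (Fin 2 × Fin 2) → (Fin 2 × Fin 2) → (Fin 2 × Fin 2) → ℂ, algBorderRank S ≤ 6 →
      ∃ Y : Fin 10 → ((Fin 2 × Fin 2) × (Fin 2 × Fin 2) → ℂ),
        ((∀ r, ∑ p, ‖Y r p‖ ^ 2 = 1) ∧ (∀ r r', r ≠ r' → ∑ p, conj (Y r p) * Y r' p = 0)) ∧
        (Module.finrank ℂ (LinearMap.range (∑ x : Fin 10 × (Fin 2 × Fin 2),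
            (LinearMap.proj x : (Fin 10 × (Fin 2 × Fin 2) → ℂ) →ₗ[ℂ] ℂ).smulRight
              (MatMulTwo.mul210 ℂ x.2 (Y x.1)))) ≤ 34 ∧
         Module.finrank ℂ (LinearMap.range (∑ x : Fin 10 × (Fin 2 × Fin 2),
            (LinearMap.proj x : (Fin 10 × (Fin 2 × Fin 2) → ℂ) →ₗ[ℂ] ℂ).smulRight
              (MatMulTwo.mul120 ℂ x.2 (Y x.1)))) ≤ 34) ∧
        ∀ r, Y r ∈ annSub S := by
  intro S hS
  obtain ⟨F, hF10, hFann, hG₁, hG₂⟩ := stub_passingFrame_exists_subspace S hS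
  -- transport `F` to the Euclidean space `ℂ^{P2 × P2}` and pick ten orthonormal vectors
  let E := EuclideanSpace ℂ ((Fin 2 × Fin 2) × (Fin 2 × Fin 2))
  let eqv : E ≃ₗ[ℂ] ((Fin 2 × Fin 2) × (Fin 2 × Fin 2) → ℂ) := WithLp.linearEquiv 2 ℂ _
  let V : Submodule ℂ E := F.comap (eqv : E →ₗ[ℂ] ((Fin 2 × Fin 2) × (Fin 2 × Fin 2) → ℂ))
  have hVF : ∀ x : E, x ∈ V ↔ WithLp.ofLp x ∈ F := fun x => Iff.rfl
  have hV : Module.finrank ℂ V = Module.finrank ℂ F := by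
    change Module.finrank ℂ (F.comap (eqv : E →ₗ[ℂ] _)) = _
    rw [Submodule.comap_equiv_eq_map_symm]
    exact LinearEquiv.finrank_map_eq _ _
  have hV10 : 10 ≤ Module.finrank ℂ V := hV ▸ hF10
  let b := stdOrthonormalBasis ℂ V
  let Y : Fin 10 → ((Fin 2 × Fin 2) × (Fin 2 × Fin 2) → ℂ) :=
    fun r => WithLp.ofLp ((b (Fin.castLE hV10 r) : V) : E)
  have hYF : ∀ r, Y r ∈ F := fun r => (hVF _).1 (b (Fin.castLE hV10 r)).2
  refine ⟨Y, ⟨?_, ?_⟩, ⟨?_, ?_⟩, fun r => hFann (hYF r)⟩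
  · intro r
    have h1 : ‖((b (Fin.castLE hV10 r) : V) : E)‖ = 1 := by
      rw [Submodule.norm_coe]
      exact b.orthonormal.1 _
    have h2 := EuclideanSpace.norm_sq_eq ((b (Fin.castLE hV10 r) : V) : E)
    rw [h1, one_pow] at h2
    exact h2.symm
  · intro r r' hrr'
    have hne : Fin.castLE hV10 r ≠ Fin.castLE hV10 r' :=
      fun h => hrr' (Fin.castLE_injective hV10 h)
    have h1 : ⟪((b (Fin.castLE hV10 r) : V) : E), ((b (Fin.castLE hV10 r') : V) : E)⟫_ℂ = 0 := by
      rw [← Submodule.coe_inner]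
      exact b.orthonormal.2 hne
    rw [PiLp.inner_apply] at h1
    simpa only [RCLike.inner_apply'] using h1
  · refine le_trans (Submodule.finrank_mono
      (t := ⨆ a₀ : (Fin 2 × Fin 2), F.map (MatMulTwo.mul210 ℂ a₀)) ?_) hG₁
    rintro _ ⟨c, rfl⟩
    rw [LinearMap.sum_apply]
    refine Submodule.sum_mem _ fun x _ => ?_
    rw [LinearMap.smulRight_apply]
    exact Submodule.smul_mem _ _ (le_iSup (fun a₀ : Fin 2 × Fin 2 => F.map (MatMulTwo.mul210 ℂ a₀))
      x.2 (Submodule.mem_map_of_mem (hYF x.1)))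
  · refine le_trans (Submodule.finrank_mono
      (t := ⨆ b₀ : (Fin 2 × Fin 2), F.map (MatMulTwo.mul120 ℂ b₀)) ?_) hG₂
    rintro _ ⟨c, rfl⟩
    rw [LinearMap.sum_apply]
    refine Submodule.sum_mem _ fun x _ => ?_
    rw [LinearMap.smulRight_apply]
    exact Submodule.smul_mem _ _ (le_iSup (fun b₀ : Fin 2 × Fin 2 => F.map (MatMulTwo.mul120 ℂ b₀))
      x.2 (Submodule.mem_map_of_mem (hYF x.1)))

end Summit.MatrixMultiplication.MatrixMultiplication.Theorems.SevenEighthsLaw
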